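import Literature.Analysis.FluidPDE.NSCoriolisTorus
import Literature.Analysis.FunctionSpaces.TorusClassicalNSUniqueness
import HarnessLib

/-!
# Uniqueness of periodic classical solutions of the rotating Navier–Stokes system

Analysis/FluidPDE proof file (theorems only; no definitions, no named facts), sequel of
`NSCoriolisTorus.lean`, supporting the named fact
`Literature.Analysis.FluidPDE.bmn1999_rotating_ns_global_regularity` (Babin–Mahalov–Nicolaenko,
Indiana Univ. Math. J. 48 (1999), Thm. 1.1; uniqueness is part of its Thm. 5.2, "there exists a
unique solution `U_s(t)` to Eqs. (1.1)", and of every restart in the bootstrap of Thm. 5.3).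

The tree's energy-method uniqueness for classical Navier–Stokes solutions on the torus
(`Torus.IsClassicalNSSolutionOn.velocity_unique`, `TorusClassicalNSUniqueness`: Majda–Bertozzi
2002, Prop. 3.1 / Cor. 3.1) assumes the two solutions share the force. Read on the torus, two
solutions of the rotating system are Navier–Stokes solutions with the *different* forces
`f − Ω e₃ × u₁`, `f − Ω e₃ × u₂` (`IsClassicalNSCoriolisSolutionOn.to_torus`), whose difference
`−Ω e₃ × (u₁ − u₂)` is however pointwise orthogonal to `u₁ − u₂`. This file therefore first
extends the energy argument to **two forces whose difference does no work on the difference of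
the velocities** (`⟪f₁ − f₂, u₁ − u₂⟫ ≤ 0` pointwise), verbatim along `TorusClassicalNSUniqueness`:

* `Torus.IsClassicalNSSolutionOn.timeDerivWithin_sub_eq_forces` — the equation for
  `w = u₁ − u₂`: `∂ₜw = ν(Δu₁ − Δu₂) − ((u₁·∇)w + (w·∇)u₂) − ∇(p₁ − p₂) + (f₁ − f₂)`;
* `Torus.IsClassicalNSSolutionOn.energy_deriv_sub_le_forces` — `E' ≤ 2(∑ᵢ|Cᵢ|) E` for
  `E = ∫ ⟪w, w⟫`, given `‖∂ᵢu₂‖ ≤ Cᵢ` and `⟪f₁ − f₂, w⟫ ≤ 0`;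
* `Torus.IsClassicalNSSolutionOn.integral_norm_sub_sq_le_mul_exp_forces` (Grönwall) and
  `Torus.IsClassicalNSSolutionOn.velocity_unique_forces`;

and then concludes for the rotating system:

* `IsClassicalNSCoriolisSolutionOn.torus_velocity_unique` — **two `ℤ³`-periodic classical
  solutions of the Navier–Stokes–Coriolis system on `ℝ³ × [a, b]` with the same viscosity
  `ν ≥ 0`, Coriolis parameter `Ω` and force, which agree at `t = a`, agree on `[a, b]`**
  (`inner_coriolisForce_self`: the Coriolis force does no work, here on the difference).

## Mathlib / tree search

Tree (reused): `Torus.IsClassicalNSSolutionOn.timeDerivWithin_sub`-type calculus,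
`Torus.laplacian_sub`, `Torus.partialDeriv_sub`, `Torus.integral_inner_convect_self_right_eq_zero`,
`Torus.integral_inner_laplacian_self_nonpos`, `Torus.eq_zero_of_integral_norm_sq_nonpos`
(`TorusClassicalNSUniqueness`), `Torus.fderiv_sub`, `Torus.gradient_sub`, `Torus.divergence_sub`
(`TorusLerayHelmholtz`), `Torus.IsSmoothSpaceTimeOn.timeDerivWithin_inner`,
`….exists_norm_le_of_isCompact` (`TorusSpaceTime`), `coriolisForce_sub`-free bookkeeping via
`coriolisForce_add/neg` (`NSCoriolis`). Mathlib: `le_gronwallBound_of_liminf_deriv_right_le`,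
`gronwallBound_ε0`. Searched `velocity_unique` with two forces / `Coriolis`: none.

## References

* A. J. Majda, A. L. Bertozzi, *Vorticity and Incompressible Flow*, CUP 2002, §3.1.1,
  Prop. 3.1 (3.7) and Cor. 3.1. [MajdaBertozziCUP2002]
* A. Babin, A. Mahalov, B. Nicolaenko, Indiana Univ. Math. J. 48 (1999), §1 (the Coriolis term
  does no work), Thm. 5.2. [BabinMahalovNicolaenko1999]
-/

open MeasureTheory Set Filter
open scoped InnerProductSpace ContDiff Topology

noncomputable section

namespace Literature.Analysis.FluidPDE

open Literature.Analysis.FunctionSpaces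

variable {d : Type*} [Fintype d] [DecidableEq d]

/-! ### The energy argument for two forces doing no work on the difference -/

section Energy

variable {a b ν : ℝ} {f₁ f₂ u₁ u₂ : ℝ → UnitAddTorus d → EuclideanSpace ℝ d}
  {p₁ p₂ : ℝ → UnitAddTorus d → ℝ}

/-- The force slice of a classical solution on `[a, b]`, `a < b`, is smooth (it is determined by
the momentum equation). [folklore] -/
theorem _root_.Literature.Analysis.FunctionSpaces.Torus.IsClassicalNSSolutionOn.isSmooth_force_slice
    {f u : ℝ → UnitAddTorus d → EuclideanSpace ℝ d} {p : ℝ → UnitAddTorus d → ℝ}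
    (h : Torus.IsClassicalNSSolutionOn (Icc a b) ν f u p) (hab : a < b) {t : ℝ}
    (ht : t ∈ Icc a b) : Torus.IsSmooth (fun x => f t x) := by
  have hut : Torus.IsSmooth (u t) := h.smooth_velocity.isSmooth_slice ht
  have hA : Torus.IsSmooth (Torus.timeDerivWithin (Icc a b) u t) :=
    h.smooth_velocity.isSmooth_timeDerivWithin (uniqueDiffOn_Icc hab) ht
  have hpt : Torus.IsSmooth (p t) := h.smooth_pressure.isSmooth_slice ht
  have hfun : (fun x => f t x) = fun x => Torus.timeDerivWithin (Icc a b) u t x +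
      Torus.convect (u t) (u t) x - ν • Torus.laplacian (u t) x + Torus.gradient (p t) x := by
    funext x
    rw [h.momentum t ht x]
    abel
  rw [hfun]
  exact ((hA.add (hut.convect hut)).sub (hut.laplacian.smul ν)).add hpt.gradient

/-- **The equation for the difference, two forces.** For classical solutions `(u₁, p₁)` with
force `f₁` and `(u₂, p₂)` with force `f₂` of the Navier–Stokes system on `[a, b] × T^d` (same
viscosity), `w = u₁ − u₂` satisfies
`∂ₜw = ν(Δu₁ − Δu₂) − ((u₁·∇)w + (w·∇)u₂) − ∇(p₁ − p₂) + (f₁ − f₂)` pointwise. [folklore] -/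
theorem _root_.Literature.Analysis.FunctionSpaces.Torus.IsClassicalNSSolutionOn.timeDerivWithin_sub_eq_forces
    (h₁ : Torus.IsClassicalNSSolutionOn (Icc a b) ν f₁ u₁ p₁)
    (h₂ : Torus.IsClassicalNSSolutionOn (Icc a b) ν f₂ u₂ p₂) (hab : a < b) {t : ℝ}
    (ht : t ∈ Icc a b) (x : UnitAddTorus d) :
    Torus.timeDerivWithin (Icc a b) (fun s y => u₁ s y - u₂ s y) t x =
      ν • (Torus.laplacian (u₁ t) x - Torus.laplacian (u₂ t) x) -
        (Torus.convect (u₁ t) (fun y => u₁ t y - u₂ t y) x +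
          Torus.convect (fun y => u₁ t y - u₂ t y) (u₂ t) x) -
        Torus.gradient (fun y => p₁ t y - p₂ t y) x + (f₁ t x - f₂ t x) := by
  have hm₁ := h₁.momentum t ht x
  have hm₂ := h₂.momentum t ht x
  have hs₁ : Torus.IsContDiff 1 (u₁ t) := (h₁.smooth_velocity.isSmooth_slice ht).isContDiff (by simp)
  have hs₂ : Torus.IsContDiff 1 (u₂ t) := (h₂.smooth_velocity.isSmooth_slice ht).isContDiff (by simp)
  have hq₁ : Torus.IsContDiff 1 (p₁ t) := (h₁.smooth_pressure.isSmooth_slice ht).isContDiff (by simp)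
  have hq₂ : Torus.IsContDiff 1 (p₂ t) := (h₂.smooth_pressure.isSmooth_slice ht).isContDiff (by simp)
  have hsub : Torus.timeDerivWithin (Icc a b) (fun s y => u₁ s y - u₂ s y) t x =
      Torus.timeDerivWithin (Icc a b) u₁ t x - Torus.timeDerivWithin (Icc a b) u₂ t x :=
    ((h₁.smooth_velocity.hasDerivWithinAt_slice ht x).sub
      (h₂.smooth_velocity.hasDerivWithinAt_slice ht x)).derivWithin (uniqueDiffOn_Icc hab t ht)
  have hconv : Torus.convect (u₁ t) (u₁ t) x - Torus.convect (u₂ t) (u₂ t) x =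
      Torus.convect (u₁ t) (fun y => u₁ t y - u₂ t y) x +
        Torus.convect (fun y => u₁ t y - u₂ t y) (u₂ t) x := by
    have hw : (fun y => u₁ t y - u₂ t y) = u₁ t - u₂ t := rfl
    simp only [Torus.convect, hw, Torus.fderiv_sub hs₁ hs₂, sub_apply, map_sub]
    abel
  have hgrad : Torus.gradient (fun y => p₁ t y - p₂ t y) x =
      Torus.gradient (p₁ t) x - Torus.gradient (p₂ t) x := by
    have hq : (fun y => p₁ t y - p₂ t y) = p₁ t - p₂ t := rfl
    rw [hq, Torus.gradient_sub hq₁ hq₂]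
  rw [hsub, hgrad, ← hconv, smul_sub]
  have e₁ := eq_sub_of_add_eq hm₁
  have e₂ := eq_sub_of_add_eq hm₂
  rw [e₁, e₂]
  abel

/-- **The energy inequality for the difference, two forces doing no work on it.** Let
`(u₁, p₁)`, `(u₂, p₂)` be classical solutions on `[a, b] × T^d` (`a < b`) with the same viscosity
`ν ≥ 0` and forces `f₁`, `f₂` such that `⟪f₁(t) − f₂(t), u₁(t) − u₂(t)⟫ ≤ 0` pointwise at the
time `t`, and let `‖∂ᵢu₂‖ ≤ Cᵢ` on `[a, b] × T^d`. Then `E(s) = ∫ ⟪u₁(s) − u₂(s), u₁(s) − u₂(s)⟫`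
has a one-sided derivative `E'(t)` within `[a, b]` at `t` with `E'(t) ≤ 2(∑ᵢ|Cᵢ|) E(t)` (as in
Majda–Bertozzi 2002, Prop. 3.1 / Cor. 3.1, the extra term `2∫ ⟪f₁ − f₂, w⟫` being `≤ 0`).
[cite: MajdaBertozziCUP2002, Prop. 3.1 and Cor. 3.1] -/
theorem _root_.Literature.Analysis.FunctionSpaces.Torus.IsClassicalNSSolutionOn.energy_deriv_sub_le_forces
    (hν : 0 ≤ ν) (h₁ : Torus.IsClassicalNSSolutionOn (Icc a b) ν f₁ u₁ p₁)
    (h₂ : Torus.IsClassicalNSSolutionOn (Icc a b) ν f₂ u₂ p₂) (hab : a < b) {C : d → ℝ}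
    (hC : ∀ i, ∀ t ∈ Icc a b, ∀ x, ‖Torus.partialDeriv i (u₂ t) x‖ ≤ C i) {t : ℝ}
    (ht : t ∈ Icc a b) (horth : ∀ x, ⟪f₁ t x - f₂ t x, u₁ t x - u₂ t x⟫_ℝ ≤ 0) :
    HasDerivWithinAt (fun s => ∫ x, ⟪u₁ s x - u₂ s x, u₁ s x - u₂ s x⟫_ℝ)
        (∫ x, Torus.timeDerivWithin (Icc a b)
          (fun s y => ⟪u₁ s y - u₂ s y, u₁ s y - u₂ s y⟫_ℝ) t x) (Icc a b) t ∧
      ∫ x, Torus.timeDerivWithin (Icc a b)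
          (fun s y => ⟪u₁ s y - u₂ s y, u₁ s y - u₂ s y⟫_ℝ) t x ≤
        (2 * ∑ i, |C i|) * ∫ x, ⟪u₁ t x - u₂ t x, u₁ t x - u₂ t x⟫_ℝ := by
  classical
  have hU : UniqueDiffOn ℝ (Icc a b) := uniqueDiffOn_Icc hab
  set w : ℝ → UnitAddTorus d → EuclideanSpace ℝ d := fun s y => u₁ s y - u₂ s y with hw_def
  have hw : Torus.IsSmoothSpaceTimeOn (Icc a b) w := h₁.smooth_velocity.sub h₂.smooth_velocity
  set L : ℝ := ∑ i, |C i| with hL_def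
  have hL0 : 0 ≤ L := Finset.sum_nonneg fun i _ => abs_nonneg _
  refine ⟨(hw.inner hw).hasDerivWithinAt_integral (convex_Icc a b) ht, ?_⟩
  have hwt : Torus.IsSmooth (w t) := hw.isSmooth_slice ht
  have hu₁t : Torus.IsSmooth (u₁ t) := h₁.smooth_velocity.isSmooth_slice ht
  have hu₂t : Torus.IsSmooth (u₂ t) := h₂.smooth_velocity.isSmooth_slice ht
  have hqt : Torus.IsSmooth (fun y => p₁ t y - p₂ t y) :=
    (h₁.smooth_pressure.isSmooth_slice ht).sub (h₂.smooth_pressure.isSmooth_slice ht)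
  have hft : Torus.IsSmooth (fun y => f₁ t y - f₂ t y) :=
    (h₁.isSmooth_force_slice hab ht).sub (h₂.isSmooth_force_slice hab ht)
  -- the force difference as one field (kept unsplit below)
  set F : ℝ → UnitAddTorus d → EuclideanSpace ℝ d := fun s y => f₁ s y - f₂ s y with hF_def
  have hFt : ∀ x, F t x = f₁ t x - f₂ t x := fun x => rfl
  have hdivw : Torus.IsDivFree (w t) := by
    intro x
    have hw' : w t = u₁ t - u₂ t := rfl
    rw [hw', Torus.divergence_sub (hu₁t.isContDiff (by simp)) (hu₂t.isContDiff (by simp)),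
      h₁.divFree t ht x, h₂.divFree t ht x, sub_zero]
  have hlapw : ∀ x, Torus.laplacian (u₁ t) x - Torus.laplacian (u₂ t) x = Torus.laplacian (w t) x := by
    intro x
    have hw' : w t = u₁ t - u₂ t := rfl
    rw [hw', Torus.laplacian_sub hu₁t hu₂t, Pi.sub_apply]
  have hpt : ∀ x, Torus.timeDerivWithin (Icc a b) (fun s y => ⟪w s y, w s y⟫_ℝ) t x =
      2 * ⟪Torus.timeDerivWithin (Icc a b) w t x, w t x⟫_ℝ := by
    intro x
    rw [hw.timeDerivWithin_inner hw hU ht x, real_inner_comm (w t x)]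
    ring
  have hderiv : ∀ x, Torus.timeDerivWithin (Icc a b) w t x =
      ν • Torus.laplacian (w t) x - (Torus.convect (u₁ t) (w t) x + Torus.convect (w t) (u₂ t) x) -
        Torus.gradient (fun y => p₁ t y - p₂ t y) x + F t x := by
    intro x
    rw [← hlapw x, hFt]
    exact h₁.timeDerivWithin_sub_eq_forces h₂ hab ht x
  have hi0 : Integrable (fun x => ⟪Torus.laplacian (w t) x, w t x⟫_ℝ) volume :=
    (hwt.laplacian.inner hwt).integrable
  have hi1 : Integrable (fun x => ⟪Torus.convect (u₁ t) (w t) x, w t x⟫_ℝ) volume :=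
    ((hu₁t.convect hwt).inner hwt).integrable
  have hi2 : Integrable (fun x => ⟪Torus.convect (w t) (u₂ t) x, w t x⟫_ℝ) volume :=
    ((hwt.convect hu₂t).inner hwt).integrable
  have hi3 : Integrable (fun x => ⟪Torus.gradient (fun y => p₁ t y - p₂ t y) x, w t x⟫_ℝ) volume :=
    (hqt.gradient.inner hwt).integrable
  have hi4 : Integrable (fun x => ⟪F t x, w t x⟫_ℝ) volume := (hft.inner hwt).integrable
  have hE't : ∫ x, Torus.timeDerivWithin (Icc a b) (fun s y => ⟪w s y, w s y⟫_ℝ) t x =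
      2 * (ν * ∫ x, ⟪Torus.laplacian (w t) x, w t x⟫_ℝ) -
        2 * (∫ x, ⟪Torus.convect (w t) (u₂ t) x, w t x⟫_ℝ) +
        2 * ∫ x, ⟪F t x, w t x⟫_ℝ := by
    have hi12 : Integrable (fun x => ⟪Torus.convect (u₁ t) (w t) x, w t x⟫_ℝ +
        ⟪Torus.convect (w t) (u₂ t) x, w t x⟫_ℝ) volume := hi1.add hi2
    have hiν : Integrable (fun x => ν * ⟪Torus.laplacian (w t) x, w t x⟫_ℝ) volume := hi0.const_mul ν
    have hiF : Integrable (fun x => ν * ⟪Torus.laplacian (w t) x, w t x⟫_ℝ -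
        (⟪Torus.convect (u₁ t) (w t) x, w t x⟫_ℝ + ⟪Torus.convect (w t) (u₂ t) x, w t x⟫_ℝ)) volume :=
      hiν.sub hi12
    have hiG : Integrable (fun x => ν * ⟪Torus.laplacian (w t) x, w t x⟫_ℝ -
        (⟪Torus.convect (u₁ t) (w t) x, w t x⟫_ℝ + ⟪Torus.convect (w t) (u₂ t) x, w t x⟫_ℝ) -
        ⟪Torus.gradient (fun y => p₁ t y - p₂ t y) x, w t x⟫_ℝ) volume := hiF.sub hi3
    simp_rw [hpt, hderiv, inner_add_left, inner_sub_left, inner_add_left, real_inner_smul_left]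
    rw [integral_const_mul, integral_add hiG hi4, integral_sub hiF hi3, integral_sub hiν hi12,
      integral_const_mul, integral_add hi1 hi2,
      Torus.integral_inner_convect_self_right_eq_zero hu₁t (h₁.divFree t ht) hwt,
      Torus.integral_inner_gradient_eq_zero_of_isDivFree hwt hqt hdivw]
    ring
  have hpw : ∀ x, |⟪Torus.convect (w t) (u₂ t) x, w t x⟫_ℝ| ≤ L * ⟪w t x, w t x⟫_ℝ := by
    intro x
    have hconv : Torus.convect (w t) (u₂ t) x = ∑ i, w t x i • Torus.partialDeriv i (u₂ t) x :=
      Torus.fderiv_apply_eq_sum_partialDeriv (hu₂t.isContDiff (by simp)) x (w t x)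
    have hnorm : ‖Torus.convect (w t) (u₂ t) x‖ ≤ L * ‖w t x‖ := by
      rw [hconv, hL_def, Finset.sum_mul]
      refine (norm_sum_le _ _).trans (Finset.sum_le_sum fun i _ => ?_)
      rw [norm_smul]
      calc ‖w t x i‖ * ‖Torus.partialDeriv i (u₂ t) x‖
          ≤ ‖w t x‖ * |C i| :=
            mul_le_mul (PiLp.norm_apply_le (w t x) i) ((hC i t ht x).trans (le_abs_self _))
              (norm_nonneg _) (norm_nonneg _)
        _ = |C i| * ‖w t x‖ := mul_comm _ _
    calc |⟪Torus.convect (w t) (u₂ t) x, w t x⟫_ℝ|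
        ≤ ‖Torus.convect (w t) (u₂ t) x‖ * ‖w t x‖ := abs_real_inner_le_norm _ _
      _ ≤ L * ‖w t x‖ * ‖w t x‖ := by gcongr
      _ = L * ⟪w t x, w t x⟫_ℝ := by rw [real_inner_self_eq_norm_sq]; ring
  have hint : |∫ x, ⟪Torus.convect (w t) (u₂ t) x, w t x⟫_ℝ| ≤ L * ∫ x, ⟪w t x, w t x⟫_ℝ := by
    rw [← integral_const_mul]
    refine abs_integral_le_integral_abs.trans (integral_mono_of_nonneg ?_ ?_ ?_)
    · exact Eventually.of_forall fun x => abs_nonneg _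
    · exact ((hwt.inner hwt).integrable).const_mul L
    · exact Eventually.of_forall hpw
  have hvisc : ν * ∫ x, ⟪Torus.laplacian (w t) x, w t x⟫_ℝ ≤ 0 :=
    mul_nonpos_of_nonneg_of_nonpos hν (Torus.integral_inner_laplacian_self_nonpos hwt)
  have hforce : ∫ x, ⟪F t x, w t x⟫_ℝ ≤ 0 :=
    integral_nonpos fun x => horth x
  have hE_eq : ∫ x, ⟪u₁ t x - u₂ t x, u₁ t x - u₂ t x⟫_ℝ = ∫ x, ⟪w t x, w t x⟫_ℝ := rfl
  have hE'_eq : ∫ x, Torus.timeDerivWithin (Icc a b)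
      (fun s y => ⟪u₁ s y - u₂ s y, u₁ s y - u₂ s y⟫_ℝ) t x
      = ∫ x, Torus.timeDerivWithin (Icc a b) (fun s y => ⟪w s y, w s y⟫_ℝ) t x := rfl
  rw [hE'_eq, hE_eq, hE't]
  have h4 := (abs_le.1 hint).1
  nlinarith [h4, hvisc, hL0, hforce]

/-- **Continuous dependence in `L²` (Grönwall), two forces doing no work on the difference**:
under the hypotheses of `Torus.IsClassicalNSSolutionOn.energy_deriv_sub_le_forces` at every time
of `[a, b]`, `∫ ‖u₁(t) − u₂(t)‖² ≤ (∫ ‖u₁(a) − u₂(a)‖²) · exp(2(∑ᵢ|Cᵢ|)(t − a))` on `[a, b]`.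
[cite: MajdaBertozziCUP2002, Prop. 3.1 and Cor. 3.1] -/
theorem _root_.Literature.Analysis.FunctionSpaces.Torus.IsClassicalNSSolutionOn.integral_norm_sub_sq_le_mul_exp_forces
    (hν : 0 ≤ ν) (h₁ : Torus.IsClassicalNSSolutionOn (Icc a b) ν f₁ u₁ p₁)
    (h₂ : Torus.IsClassicalNSSolutionOn (Icc a b) ν f₂ u₂ p₂) (hab : a < b) {C : d → ℝ}
    (hC : ∀ i, ∀ t ∈ Icc a b, ∀ x, ‖Torus.partialDeriv i (u₂ t) x‖ ≤ C i)
    (horth : ∀ t ∈ Icc a b, ∀ x, ⟪f₁ t x - f₂ t x, u₁ t x - u₂ t x⟫_ℝ ≤ 0) {t : ℝ}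
    (ht : t ∈ Icc a b) :
    ∫ x, ‖u₁ t x - u₂ t x‖ ^ 2 ≤
      (∫ x, ‖u₁ a x - u₂ a x‖ ^ 2) * Real.exp ((2 * ∑ i, |C i|) * (t - a)) := by
  classical
  set E : ℝ → ℝ := fun s => ∫ x, ⟪u₁ s x - u₂ s x, u₁ s x - u₂ s x⟫_ℝ with hE_def
  set E' : ℝ → ℝ := fun s => ∫ x, Torus.timeDerivWithin (Icc a b)
    (fun σ y => ⟪u₁ σ y - u₂ σ y, u₁ σ y - u₂ σ y⟫_ℝ) s x with hE'_def
  have hE : ∀ s ∈ Icc a b, HasDerivWithinAt E (E' s) (Icc a b) s ∧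
      E' s ≤ (2 * ∑ i, |C i|) * E s := fun s hs =>
    h₁.energy_deriv_sub_le_forces hν h₂ hab hC hs (horth s hs)
  have hEc : ContinuousOn E (Icc a b) := fun s hs => (hE s hs).1.continuousWithinAt
  have hder : ∀ s ∈ Ico a b, HasDerivWithinAt E (E' s) (Ici s) s := fun s hs =>
    ((hE s (Ico_subset_Icc_self hs)).1.mono (Icc_subset_Icc hs.1 le_rfl)).mono_of_mem_nhdsWithin
      (Icc_mem_nhdsGE hs.2)
  have hgr := le_gronwallBound_of_liminf_deriv_right_le (f := E) (f' := E') (δ := E a)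
    (K := 2 * ∑ i, |C i|) (ε := 0) (a := a) (b := b) hEc
    (fun s hs r hr => (hder s hs).liminf_right_slope_le hr) le_rfl
    (fun s hs => by
      rw [add_zero]
      exact (hE s (Ico_subset_Icc_self hs)).2) t ht
  rw [gronwallBound_ε0] at hgr
  have hEeq : ∀ s, E s = ∫ x, ‖u₁ s x - u₂ s x‖ ^ 2 := fun s => by
    simp only [hE_def, real_inner_self_eq_norm_sq]
  rw [hEeq, hEeq] at hgr
  exact hgr

/-- **Uniqueness, two forces doing no work on the difference**: two classical solutions on
`[a, b] × T^d` with the same viscosity `ν ≥ 0` and forces `f₁`, `f₂` with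
`⟪f₁ − f₂, u₁ − u₂⟫ ≤ 0` pointwise on `[a, b] × T^d`, which agree at `t = a`, agree on `[a, b]`
(Majda–Bertozzi 2002, Cor. 3.1, whose proof this is). [cite: MajdaBertozziCUP2002, Cor. 3.1] -/
theorem _root_.Literature.Analysis.FunctionSpaces.Torus.IsClassicalNSSolutionOn.velocity_unique_forces
    (hν : 0 ≤ ν) (h₁ : Torus.IsClassicalNSSolutionOn (Icc a b) ν f₁ u₁ p₁)
    (h₂ : Torus.IsClassicalNSSolutionOn (Icc a b) ν f₂ u₂ p₂)
    (horth : ∀ t ∈ Icc a b, ∀ x, ⟪f₁ t x - f₂ t x, u₁ t x - u₂ t x⟫_ℝ ≤ 0)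
    (h0 : u₁ a = u₂ a) {t : ℝ} (ht : t ∈ Icc a b) : u₁ t = u₂ t := by
  classical
  rcases lt_or_ge a b with hab | hba
  · have hU : UniqueDiffOn ℝ (Icc a b) := uniqueDiffOn_Icc hab
    obtain ⟨C, hC⟩ : ∃ C : d → ℝ, ∀ i, ∀ s ∈ Icc a b, ∀ x,
        ‖Torus.partialDeriv i (u₂ s) x‖ ≤ C i := by
      have hbd : ∀ i : d, ∃ c : ℝ, ∀ s ∈ Icc a b, ∀ x, ‖Torus.partialDeriv i (u₂ s) x‖ ≤ c :=
        fun i => (h₂.smooth_velocity.partialDeriv hU i).exists_norm_le_of_isCompact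
          isCompact_Icc subset_rfl
      choose C hC using hbd
      exact ⟨C, hC⟩
    have h := h₁.integral_norm_sub_sq_le_mul_exp_forces hν h₂ hab hC horth ht
    have hzero : ∫ x, ‖u₁ a x - u₂ a x‖ ^ 2 = 0 := by simp [h0]
    rw [hzero, zero_mul] at h
    have hw : Torus.IsSmooth (u₁ t - u₂ t) :=
      (h₁.smooth_velocity.isSmooth_slice ht).sub (h₂.smooth_velocity.isSmooth_slice ht)
    exact sub_eq_zero.1 (Torus.eq_zero_of_integral_norm_sq_nonpos hw h)
  · have hta : t = a := le_antisymm (ht.2.trans hba) ht.1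
    rw [hta, h0]

end Energy

/-! ### The rotating system -/

namespace IsClassicalNSCoriolisSolutionOn

variable {a b ν Ω : ℝ} {f u₁ u₂ : ℝ → UnitAddTorus (Fin 3) → EuclideanSpace ℝ (Fin 3)}
  {p₁ p₂ : ℝ → UnitAddTorus (Fin 3) → ℝ}

/-- **The Coriolis forces of two solutions do no work on their difference**:
`⟪(f − Ω e₃ × u₁) − (f − Ω e₃ × u₂), u₁ − u₂⟫ = −⟪Ω e₃ × (u₁ − u₂), u₁ − u₂⟫ = 0` pointwise
(`inner_coriolisForce_self`). [folklore] -/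
theorem inner_force_sub_force_eq_zero (f u₁ u₂ : ℝ → UnitAddTorus (Fin 3) → EuclideanSpace ℝ (Fin 3))
    (Ω t : ℝ) (x : UnitAddTorus (Fin 3)) :
    ⟪(f t x - coriolisForce Ω (u₁ t x)) - (f t x - coriolisForce Ω (u₂ t x)),
      u₁ t x - u₂ t x⟫_ℝ = 0 := by
  have hsub : (f t x - coriolisForce Ω (u₁ t x)) - (f t x - coriolisForce Ω (u₂ t x)) =
      -coriolisForce Ω (u₁ t x - u₂ t x) := by
    rw [sub_eq_add_neg (u₁ t x), coriolisForce_add, ← neg_one_smul ℝ (u₂ t x),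
      coriolisForce_smul, neg_one_smul]
    abel
  rw [hsub, inner_neg_left, inner_coriolisForce_self, neg_zero]

/-- **Uniqueness of periodic classical solutions of the rotating Navier–Stokes system.** Two
`ℤ³`-periodic classical solutions of the Navier–Stokes–Coriolis system on `ℝ³ × [a, b]` with the
same viscosity `ν ≥ 0`, Coriolis parameter `Ω` and force, read on the torus, whose velocities
agree at `t = a`, have the same velocity on `[a, b]`: on the torus they solve the Navier–Stokes
system with forces `f − Ω e₃ × uᵢ` (`to_torus`), whose difference does no work on `u₁ − u₂`
(`inner_force_sub_force_eq_zero`), so the energy method applies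
(`Torus.IsClassicalNSSolutionOn.velocity_unique_forces`; Majda–Bertozzi 2002, Cor. 3.1; BMN 1999,
Thm. 5.2: "there exists a unique solution"). [cite: BabinMahalovNicolaenko1999, Thm. 5.2 (uniqueness clause)] -/
theorem torus_velocity_unique (hν : 0 ≤ ν)
    (h₁ : IsClassicalNSCoriolisSolutionOn (Icc a b) ν Ω (fun t => Torus.lift (f t))
      (fun t => Torus.lift (u₁ t)) (fun t => Torus.lift (p₁ t)))
    (h₂ : IsClassicalNSCoriolisSolutionOn (Icc a b) ν Ω (fun t => Torus.lift (f t))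
      (fun t => Torus.lift (u₂ t)) (fun t => Torus.lift (p₂ t)))
    (h0 : u₁ a = u₂ a) {t : ℝ} (ht : t ∈ Icc a b) : u₁ t = u₂ t :=
  h₁.to_torus.velocity_unique_forces hν h₂.to_torus
    (fun s _ x => (inner_force_sub_force_eq_zero f u₁ u₂ Ω s x).le) h0 ht

/-- The same for the lifted (periodic) velocity fields on `ℝ³`. [cite: BabinMahalovNicolaenko1999, Thm. 5.2 (uniqueness clause)] -/
theorem lift_velocity_unique (hν : 0 ≤ ν)
    (h₁ : IsClassicalNSCoriolisSolutionOn (Icc a b) ν Ω (fun t => Torus.lift (f t))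
      (fun t => Torus.lift (u₁ t)) (fun t => Torus.lift (p₁ t)))
    (h₂ : IsClassicalNSCoriolisSolutionOn (Icc a b) ν Ω (fun t => Torus.lift (f t))
      (fun t => Torus.lift (u₂ t)) (fun t => Torus.lift (p₂ t)))
    (h0 : u₁ a = u₂ a) {t : ℝ} (ht : t ∈ Icc a b) :
    Torus.lift (u₁ t) = Torus.lift (u₂ t) := by
  rw [torus_velocity_unique hν h₁ h₂ h0 ht]

end IsClassicalNSCoriolisSolutionOn

end Literature.Analysis.FluidPDE

end
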